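import Literature.MathematicalPhysics.QuantumFieldTheory.Balaban1983to89.B8Prop6OfThm4

/-!
# `Balaban1983to89.B8Eq119TwistedAxial` — B8 (1.16)–(1.20): the axial gauge `Ax_k(𝔅_k, U₀)` RELATIVE TO A GENERAL
# BACKGROUND `U₀` on the `ℤᵈ` tower of averages (43); p. 79 "The conditions (1.19) determine uniquely an element
# in each orbit given by the subgroup (1.14)" REDUCED to the case `U₀ = 1` ((1.15), `B8Eq115GaugeFixing`);
# Theorem 4 (p. 88) as an interface for a general background, specialised to the pair `1, U₀″` of p. 99; (1.29)

T. Bałaban, *Spaces of regular gauge field configurations on a lattice and gauge fixing conditions*, Commun.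
Math. Phys. **99** (1985) 75–102 `[Balaban1985RegularSpaces]` ("B8"), Sect. B pp. 78–82, Theorem 4 p. 88, Sect. F
p. 99; "[3]" = T. Bałaban, *Averaging operations for lattice gauge theories*, Commun. Math. Phys. **98** (1985)
17–51 `[Balaban1985Averaging]` ("B7"; (8) p. 18, (43) p. 24, (78)–(80) p. 30); "[4]" = T. Bałaban, *Propagators
for lattice gauge theories in a background field*, Commun. Math. Phys. **99** (1985) 389–434
`[Balaban1985BackgroundPropagators]` ("B9", B8's reference 4 p. 102; its (3.35) is only NAMED here).  STATUS: a published, refereed paper;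
this file TYPES the printed definitions (1.16)–(1.20) for a GENERAL background `U₀` on the tree's `ℤᵈ` carriers —
the twisted variables (1.20) and the class `Ax_k(𝔅_k, U₀)` of (1.19) are expressed through the tree's certified
(1.19)-product `B8Lemma1NonAbelian.covProd` and (1.20)-perturbation `B8Lemma1NonAbelian.pert` (gen. 17) on the
averages (43) `B7Prop2Explicit.avgIter` — PROVES the printed-but-unproved sentence p. 79 "The conditions (1.19)
determine uniquely an element in each orbit given by the subgroup (1.14)" on the global carrier by REDUCTION to the
tree's certification of the same sentence for (1.15) (`B8Eq115GaugeFixing`, gen. 19: `u = v₀⁻¹v` with `v`, `v₀`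
the axial gauges of `U`, `U₀`), TYPES Theorem 4 (p. 88) as an interface for a general background (the companion
`B8Prop6OfThm4`, gen. 21, typed it for `U₀ = 1` only) and PROVES that its specialisation to the pair `1, U₀″` is
that interface — hence Proposition 6 from the general interface — and TYPES (1.29) on the `ℤᵈ` blocks with the
tree's averaging operation (79)–(80) `B7Eq78Linearization.Rbar`.  Theorem 4 itself (Sects. C–E) is the paper's
main result and is NOT certified here; no programme-internal claim is used; every `theorem` below is `sorry`-free
over Mathlib and the tree.

## THE PRINTED TEXT (verbatim; renders `1985-cmp99-regular-spaces-gauge-fixing-pNNN-x2.png`, PDF page =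
## journal page − 74)

p. 76 [PDF 2]: "where `U` is an arbitrary gauge field configuration, and `R(U)X = UXU⁻¹` for a unitary matrix `U`
and an arbitrary `X`."

p. 78 [PDF 4]: "`𝔅_k = ⋃_{j=0}^{k} Λ_j` (1.12) … `𝔅_k(𝔅_k, V)` is a set of all gauge field configurations `U`
satisfying the conditions `Ūʲ = V` on `Λ_j`, `j = 0, …, k`. (1.13)  Because `(\overline{U^u}{}^j)_b = (Ūʲ)ᵘ_b =
u(b₋)(Ūʲ)_b u⁻¹(b₊)` for `b ⊂ T^{(j)}`, hence the set `𝔅_k(𝔅_k, V)` is invariant with respect to gauge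
transformations `u` satisfying the conditions `u(y) = 1` for `y ∈ 𝔅_k`. (1.14)  They form a subgroup of the group
of all gauge transformations and we are interested in spaces of orbits of this subgroup."  …  "It is easy to see
that these equations [(1.15)] together with (1.14) for gauge transformations determine uniquely an element in each
orbit.  We will choose gauge conditions relative to some fixed configuration `U₀`. This means that if we consider
new variables `U′` defined by `U = U′U₀`, or `U′ = UU₀⁻¹`, (1.16) then the conditions are imposed on the variables
`U′`, and the surfaces pass through the element `U₀`. If we apply a gauge transformation `u` to `U` and if we demand
that in the above representation for `Uᵘ` the configuration `U₀` is unchanged, then we get the following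
transformation law for the configurations `U′`: `U′ᵘ(x, x′) = u(x)U′(x, x′)R(U₀(x, x′))u⁻¹(x′)`. (1.17)  If we are
interested in a dependence on `U₀`, then we may consider another point of view. We demand that `U` and `U₀` are
transformed in the usual way, and then we get for `ᵘU′ = Uᵘ(U₀ᵘ)⁻¹`: `ᵘU′(x, x′) = R(u(x))U′(x, x′)`. (1.18)
Defining gauge conditions we will use the first point of view expressed in the transformation law (1.17)."

p. 79 [PDF 5]: "Now let us define the axial gauge conditions relative to `U₀`. They were introduced in [3], (64–72)
by the conditions: for `x₀ ∈ Bʲ(x_j)`, `x_j ∈ Λ_j`, `1 ≤ j ≤ k`, we define a sequence of points `x₀, x₁, …,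
x_{j−1}, x_j` by the conditions `x_n ∈ B(x_{n+1})`, `n = 0, 1, …, j − 1`, and we put
`(R̄ⁿ_{0,x_{n+1}} Ũ′ⁿ)(Γ_{x_{n+1},x_n}) = ∏_{b⊂Γ_{x_{n+1},x_n}} R(Ū₀ⁿ(Γ_{x_{n+1},b₋})) Ũ′ⁿ_b = 1`. (1.19)
Let us recall that the average `Ũ′ⁿ` was defined in [3] as `Ũ′ⁿ = (\overline{U′U₀})ⁿ(Ū₀ⁿ)⁻¹`. (1.20)  The
conditions (1.19) determine uniquely an element in each orbit given by the subgroup (1.14). We denote this gauge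
condition by `Ax_k(𝔅_k, U₀)`."

p. 81 [PDF 7]: "`U′U₀ ∈ 𝔄_k({Ω_j}, α₀) ∩ 𝔅_k(𝔅_k, V) ∩ Ax_k(𝔅_k, U₀)`, (1.28) … Instead of them we will
consider the restrictions `(\overline{R₀u}{}^j)(y) = 1` for `y ∈ Λ_j`, `j = 0, 1, …, k`, (1.29) where `\overline{R₀u}{}^j`
denotes a `j`-th order averaging operation for gauge transformations, e.g., the operation defined by (79), (80)
in [3]."

p. 82 [PDF 8]: "`U₀ ∈ 𝔄_k({Ω_j}, α₀)`, `U₀` satisfies the regularity condition (3.35) in [4]. (1.33)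
`U′U₀ ∈ 𝔄_k({Ω_j}, α₀) ∩ Ax_k(𝔅_k, U₀)`, (1.34)".   p. 87 [PDF 13]: "`|(\overline{U′U₀})ʲ − Ū₀ʲ| = |Ũ′ʲ − 1|
< α₁` on `Ω_j^{(j)}`, `j = 0, 1, …, k`. (1.66)".

p. 88 [PDF 14], Theorem 4: "There exists a constant `c₁` such that for arbitrary `U₀`, `U′U₀` satisfying (1.33),
(1.34), (1.66) with `α₀ + α₁ ≤ c₁` there exists exactly one gauge transformation `u` satisfying (1.29) and such
that the conditions (1.37), (1.38), (1.62) hold for the configuration `U₁ = U′^{u⁻¹}`."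

p. 99 [PDF 25]: "If `7dL²Mα₀ ≤ c₁`, then the assumptions of Theorem 4 are satisfied for the pair of configurations
`1, U₀″`, thus there exists a gauge transformation `u` such that `U₁ = U₀″^{u⁻¹}` satisfies the conditions
(1.36)–(1.39)" … "The configuration `U₁` in a neighborhood of `□` is obtained from `U₀` by a gauge transformation,
hence for `α₀` sufficiently small we have proved the regularity condition (3.35). This implies that we can drop out
this condition from the assumption (1.33)."

## WHAT IS CERTIFIED HERE (kernel, axioms `propext`/`Classical.choice`/`Quot.sound` only)

On the `ℤᵈ` carriers of `B7Prop1Explicit`/`B7Prop2Explicit` (`Ūʲ = avgIter L U j`; corner blocks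
`B(Lz) = {Lz + r : r ∈ [0, L)ᵈ}` with the tree contours `Γ_{Lz,x} = treeWord (x − Lz)` of [3] p. 24):
* §1 (pure group algebra, any group `G`): (1.16) `U = U′U₀` / `U′ = UU₀⁻¹` ARE the tree's
  `B8Lemma1NonAbelian.mulCfg` / `pert` (`mulCfg_pert`, and the tree's `pert_mulCfg`); **(1.17)** verbatim
  (`eq117`: the action `u` on `U = U′U₀` with `U₀` fixed, read on `U′`, is `u(x)U′(x,x′)R(U₀(x,x′))u⁻¹(x′)`);
  **(1.18)** verbatim (`eq118`); the background is on every relative gauge surface, p. 78 "the surfaces pass through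
  the element `U₀`" (`pert_self`, `covProd_one_right`); for the trivial background the (1.19)-product IS the plain
  transporter of (1.15) (`covProd_one_left`); **(1.19) ⟺ equality of the transporters of `U′U₀` and `U₀` along the
  block contour** (`covProd_treeWord_eq_one_iff`, from the tree's `covProd_eq_one_iff`: the product in (1.19)
  telescopes to `(\overline{U′U₀})ⁿ(Γ)·Ū₀ⁿ(Γ)⁻¹`);
* §2 **`InAx L k Λ U₀ W`** = "`W ∈ Ax_k(ℭ, U₀)`", (1.19) VERBATIM for a general background on the tower (43): for
  every `x_j ∈ Λ_j`, `1 ≤ j ≤ k`, every chain of blocks below it and every `x_n ∈ B(x_{n+1})`: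
  `∏_{b⊂Γ_{x_{n+1},x_n}} R(Ū₀ⁿ(Γ_{x_{n+1},b₋})) Ũ′ⁿ_b = 1` with `Ũ′ⁿ = pert (W̄ⁿ) (Ū₀ⁿ)` ((1.20); on the averages
  of `W = U′·U₀` this is gen-21's bondwise `B8Prop6OfThm4.tavg`, `pert_avgIter`); `inAx_iff` (⟺ `W̄ⁿ(Γ_{Lz,x}) =
  Ū₀ⁿ(Γ_{Lz,x})`); **`inAx_one_iff`: `Ax_k(ℭ, 1)` IS gen-20's `B8Ineq132.InAxOne`** ((1.15) below `ℭ`, the form in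
  which (1.34) was typed for the pair `1, U₀″` in `B8Prop6OfThm4.Thm4AtOne`); `inAx_self` (`U₀ ∈ Ax_k(ℭ, U₀)`);
  `inAx_of_global`, `inAx_of_tower` (membership from (1.19) at all blocks, resp. on the tower of cubes);
* §3 **p. 79 "The conditions (1.19) determine uniquely an element in each orbit given by the subgroup (1.14)"**,
  GLOBAL CARRIER, for bond fields valued in an `AvgClosed` gauge group `G` under (1.7) for `U₀` and `U` with the
  Prop. 1/2 smallness of [3] (the hypotheses of the tree's covariance theorem `B7AvgGaugeCovariance.avgIter_gaugeAct`,
  p. 78 "`(\overline{U^u}{}^j)_b = (Ūʲ)ᵘ_b`"): `twGauge L U₀ U k y := v₀⁻¹·v`, `v = towerGauge L U k y`,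
  `v₀ = towerGauge L U₀ k y` (the tree's solutions of (1.15) for `U` and `U₀`, `B8Eq115GaugeFixing.gaugeFix_global`);
  TRANSFER LEMMAS `twisted_of_fixed` / `fixed_of_twisted` (`w` solves (1.15) for `U` iff `v₀⁻¹w` solves (1.19)
  relative to `U₀`, levelwise, top level included — pure gauge algebra (8) of [3] on top of the covariance);
  **`twistedFix_global`** — EXISTENCE: `u = twGauge …` and `U^{u}` are `G`-valued, plaquette deviations are
  unchanged, `u(Lᵏy) = 1` ((1.14) at the top center), (1.19) holds between ALL consecutive levels at every block of
  `ℤᵈ` (`\overline{U^u}{}^j(Γ_{Lz,x}) = Ū₀ʲ(Γ_{Lz,x})`), and the top level is in the axial gauge RELATIVE TO `Ū₀ᵏ` at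
  `y` (`\overline{U^u}{}^k(Γ_{y,z}) = Ū₀ᵏ(Γ_{y,z})`); `inAx_twistedFix` (`U^{u} ∈ Ax_k(ℭ, U₀)` for every `ℭ`);
  **`twistedFix_unique`** — UNIQUENESS modulo the residual freedom `u ↦ v₀⁻¹c v₀·u`, `c ∈ G` constant (which acts:
  `twistedFix_conjConst_mul`); **`twistedFix_unique_normalised`** — EXACT uniqueness under `u(Lᵏy) = 1`;
  `twGauge_one_bg` (for `U₀ = 1` all of this is `B8Eq115GaugeFixing` verbatim: `v₀ = 1`, `towerGauge_one`);
* §4 **`Thm4At`** — Theorem 4 (p. 88) as an explicitly displayed HYPOTHESIS SHAPE for a GENERAL background on the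
  admissible family `{□_j}` of (1.131): (1.33) = `InAk U₀ ∧ Reg U₀` (`Reg` abstracts "(3.35) in [4]"), (1.34) =
  `InAk (U′·U₀) ∧ InAx … U₀ (U′·U₀)`, (1.66) = `B8Prop6OfThm4.Cond166 U₀ U′ α₁`, `Restr U₀ u` abstracts (1.29),
  `Concl` abstracts (1.37), (1.38), (1.62); **`thm4AtOne_of_thm4At`** — its specialisation to the pair `1, U′`
  (with `Reg 1`, the clause print drops on p. 99) IS gen-21's `B8Prop6OfThm4.Thm4AtOne` (`U′·1 = U′`,
  `inAx_one_iff`); **`prop6_of_thm4At`** — Proposition 6 ((1.135), existence, uniqueness) from the GENERAL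
  interface (`B8Prop6OfThm4.prop6_of_thm4 ∘ thm4AtOne_of_thm4At`);
* §5 **`Restr129`** — (1.29) "`(\overline{R₀u}{}^j)(y) = 1` for `y ∈ Λ_j`, `j = 0, 1, …, k`" TYPED with the tree's
  `j`-th order averaging operation (79)–(80) `B7Eq78Linearization.Rbar` on the `ℤᵈ` blocks `zdBlocking d L` and the
  background transporters `bgT L U₀ j y x = Ū₀ʲ(Γ_{Ly,x})`; `restr129_level_zero` (`j = 0`: `u = 1` on `Λ₀`, i.e.
  (1.14) there), `bgT_one`, `restr129_one_iff` (for `U₀ = 1` all transporters are `1`), `blockBase_eq_smul`.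

## DICTIONARY (print ↦ this file)

As in `B8Eq115GaugeFixing` / `B8Ineq132` / `B8Prop6OfThm4` (levels `ℤᵈ`, `x_j ∈ Λ_j ⊂ T^{(j)}` ↦ `xj ∈ Λ j`,
`x_{n+1}` ↦ `z`, `B(x_{n+1})` ↦ `{Lz + boxVec L r}`, `Bʲ⁻ⁿ⁻¹(x_j) ∋ x_{n+1}` ↦ `B8Ineq132.Under L (j − (n+1)) xj z`,
`Γ_{x_{n+1},x_n}` ↦ `treeWord (boxVec L r)` from the corner `L•z`, `Ūⁿ` ↦ `avgIter L U n`, `U^{u}` ↦ `gaugeAct u U`,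
gauge group ↦ an `AvgClosed` subgroup `G ≤ {|u| ≤ 1, |u⁻¹| ≤ 1}` of `𝔸ˣ`); in addition: `R(X)Y = XYX⁻¹` ↦
conjugation in `𝔸ˣ` (`B7Eq78Linearization.conjR` on `𝔸`); (1.16) `U′ = UU₀⁻¹` ↦ `pert U U₀`, `U′U₀` ↦ `mulCfg U′ U₀ =
U′ * U₀`; (1.20) `Ũ′ⁿ` ↦ `pert (avgIter L W n) (avgIter L U₀ n)` (`= tavg L U₀ U′ n` for `W = U′ * U₀`); the product
(1.19) `∏_{b⊂Γ} R(Ū₀ⁿ(Γ_{x_{n+1},b₋})) Ũ′ⁿ_b` ↦ `covProd (avgIter L U₀ n) (Ũ′ⁿ) (L•z) (treeWord (boxVec L r))`;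
`Ax_k(𝔅_k, U₀) ∋ W` ↦ `InAx L k Λ U₀ W`; the orbit element ↦ `gaugeAct (twGauge L U₀ U k y) U`; (1.14) at the top
center ↦ `u (Lᵏ•y) = 1`; (1.29) `\overline{R₀u}{}^j` ↦ `Rbar (zdBlocking d L) (bgT L U₀) j u` (base points = block
corners `blockBase L y = L•y`, weights `L⁻ᵈ`, transporters `Ū₀ʲ(Γ_{Ly,x})`); (3.35) of [4] ↦ the abstract `Reg`.

## HONEST SCOPE (what is NOT certified here)

(i) Theorem 4 (Sects. C–E, the Landau-type gauge (1.29)/(1.36)–(1.39)/(1.62) and its analysis) is NOT certified: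
`Thm4At` is an interface whose `Reg`, `Restr`, `Concl` are abstract predicates; `Restr129` types (1.29) but is not
wired into `Thm4At` (its partner `Concl` stays untyped), and `Reg` ("(3.35) in [4]") is only named.  (ii) As in
`B8Eq115GaugeFixing` HONEST SCOPE (i)–(ii): print's orbits are those of the subgroup (1.14) (`u = 1` on all of
`𝔅_k ⊂ T_η`) and (1.19) is imposed below the points of `𝔅_k` only; the existence/uniqueness certified in §3 is for
the GLOBAL configuration of conditions on `ℤᵈ` — (1.19) at every block of every level `< k`, and at the top level
the axial gauge relative to `Ū₀ᵏ` based at one point `y` with (1.14) at that point — i.e. exactly the carrier on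
which the tree certified (1.15) (and which Sect. F uses, p. 98); uniqueness is modulo the conjugated constants
`v₀⁻¹cv₀` without the normalisation and exact with it.  The class `InAx` itself is typed for an arbitrary family
`Λ`.  (iii) All §3 statements carry the analyticity hypotheses of the tree's covariance theorem for BOTH `U₀` and `U`
((1.7) in the global form `sup_p |·(∂p) − 1| < α₀L²·L^{−2k}`, `C₀α₀L² ≤ ⅓`, `2α₀L² ≤ c₂′`), print: "`α₀` is so small
that … all the theorems on averaging operations are valid".  (iv) ORIENTATION: the contours `Γ_{x_{n+1},x_n}` of
(1.19) consist of positively oriented bonds (corner convention of [3] p. 24 as read in the tree), and the tree's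
`covProd` is print's product on such contours (`treeWord_boxVec_forward`); nothing is asserted about (1.19)-type
products along contours with reversed bonds.  (v) `ℤᵈ` at every level instead of the finite torus `T_η`; strict
`<` in (1.66) as printed.  (vi) The sentence p. 99 "we have proved the regularity condition (3.35) … we can drop out
this condition" is represented only as the displayed hypothesis `Reg 1` of `thm4AtOne_of_thm4At` /
`prop6_of_thm4At`, not proved.

RELATED TREE WORK (cross-lineage, NOT re-used — different carriers and coarse-graining): `T4RelativeComb`,
`T4RelativeCombCrossing` (`pert`, `TreeRel`, `combGauge`: a one-block RELATIVE comb gauge `V = U₀` on tree bonds),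
`T4MultilevelCombGauge` (its multilevel iteration for the STRAIGHT coarse transports `scaled L U`); the present file
treats the AVERAGED tower (43) of [3] in the printed form (1.19)/(1.20) consumed by (1.34) and `B8Prop6OfThm4`.
-/

noncomputable section

open scoped BigOperators
open Finset

namespace Literature.MathematicalPhysics.QuantumFieldTheory.Balaban1983to89.B8Eq119TwistedAxial

open B7Prop1Explicit B7Prop2Explicit B7Prop1Local B7AvgGaugeCovariance B8Ineq130 B8Eq115GaugeFixing B8Ineq133
  B8Ineq132 B8Eq131Cubes B8Ineq129 B8Prop6OfThm4 MatrixLog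
open B7Eq78Linearization (conjR conjR_apply Rbar Rbar_zero zdBlocking)
open B8Lemma1NonAbelian (mulCfg pert pert_mulCfg covProd hol_mulCfg_eq_covProd_mul covProd_eq_one_iff
  forward_of_mem_treeWord boxVec_nonneg)
open Literature.MathematicalPhysics.QuantumLattice (blockBase blockSites)
export B7Prop1Explicit (Site)

variable {d : ℕ}

/-! ## §1. (1.16)–(1.20) as pure gauge algebra (any group `G`): the tree's `mulCfg` / `pert` / `covProd` -/

section Algebra

variable {G : Type*} [Group G]

/-- **(1.16)** `U = U′U₀`: the full field recovered from the perturbation `U′ = UU₀⁻¹` (`B8Lemma1NonAbelian.pert`)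
and the background (`B8Lemma1NonAbelian.mulCfg`; the tree has the companion `pert_mulCfg : (U′U₀)U₀⁻¹ = U′`).
[cite: Balaban1985RegularSpaces, (1.16) p.78] -/
theorem mulCfg_pert (U U₀ : Site d → Fin d → G) : mulCfg (pert U U₀) U₀ = U := by
  funext x μ; simp [pert, mulCfg]

/-- (1.16), bondwise product: `U′U₀` is the pointwise product `U′ * U₀` of the bond fields. [folklore] -/
theorem mulCfg_eq_mul (U' U₀ : Site d → Fin d → G) : mulCfg U' U₀ = U' * U₀ := rfl

/-- **(1.17) VERBATIM**: "If we apply a gauge transformation `u` to `U` and if we demand that in the above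
representation for `Uᵘ` the configuration `U₀` is unchanged, then we get the following transformation law for the
configurations `U′`: `U′ᵘ(x, x′) = u(x)U′(x, x′)R(U₀(x, x′))u⁻¹(x′)`" — `U′ᵘ := Uᵘ U₀⁻¹ = (U′U₀)ᵘ U₀⁻¹`,
`R(X)Y = XYX⁻¹` (p. 76), `x′ = x + e_μ`, `Uᵘ(x, x′) = u(x)U(x, x′)u(x′)⁻¹` ((8) of [3], `B7Prop1Explicit.gaugeAct`).
[cite: Balaban1985RegularSpaces, (1.17) p.78] -/
theorem eq117 (u : Site d → G) (U' U₀ : Site d → Fin d → G) (x : Site d) (μ : Fin d) :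
    pert (gaugeAct u (mulCfg U' U₀)) U₀ x μ = u x * U' x μ * (U₀ x μ * (u (x + e μ))⁻¹ * (U₀ x μ)⁻¹) := by
  simp only [pert, gaugeAct, mulCfg, mul_assoc]

/-- **(1.18) VERBATIM**: "We demand that `U` and `U₀` are transformed in the usual way, and then we get for
`ᵘU′ = Uᵘ(U₀ᵘ)⁻¹`: `ᵘU′(x, x′) = R(u(x))U′(x, x′)`." [cite: Balaban1985RegularSpaces, (1.18) p.78] -/
theorem eq118 (u : Site d → G) (U U₀ : Site d → Fin d → G) (x : Site d) (μ : Fin d) :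
    pert (gaugeAct u U) (gaugeAct u U₀) x μ = u x * pert U U₀ x μ * (u x)⁻¹ := by
  simp only [pert, gaugeAct, mul_inv_rev, inv_inv, mul_assoc, inv_mul_cancel_left]

/-- `Ũ = 1` for `U′ = 1`, i.e. `U = U₀` ((1.16)): the background's own perturbation. [folklore] -/
theorem pert_self (U₀ : Site d → Fin d → G) : pert U₀ U₀ = 1 := by
  funext x μ; simp [pert]

/-- p. 78 "the surfaces pass through the element `U₀`": the (1.19)-product `∏_{b⊂Γ} R(V₀(Γ_{x,b₋})) 1 = 1` of the
trivial perturbation (`B8Lemma1NonAbelian.covProd`, gen. 17: `(R(V₀)V′)(Γ) = ∏_{b⊂Γ} R(V₀(Γ_{x,b₋})) V′_b`).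
[cite: Balaban1985RegularSpaces, p.78, (1.19) p.79] -/
theorem covProd_one_right (V₀ : Site d → Fin d → G) :
    ∀ (x : Site d) (w : List (Letter d)), covProd V₀ 1 x w = 1
  | x, [] => rfl
  | x, l :: w => by
    rw [covProd, covProd_one_right V₀ (x + l.vec) w]
    simp

/-- **(1.19) FOR `U₀ = 1` IS (1.15)**: with the trivial background every `R(1̄(·)) = id` and the (1.19)-product
along a (positively oriented) contour is the plain parallel transporter `V′(Γ)` of (1.15)
(the tree's `hol_mulCfg_eq_covProd_mul` with `V₀ = 1`). [cite: Balaban1985RegularSpaces, (1.15) p.78, (1.19) p.79] -/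
theorem covProd_one_left (V' : Site d → Fin d → G) (x : Site d) (w : List (Letter d))
    (hw : ∀ l ∈ w, l = (l.1, true)) : covProd (1 : Site d → Fin d → G) V' x w = hol V' x w := by
  have h := hol_mulCfg_eq_covProd_mul 1 V' x w hw
  have h1 : mulCfg V' (1 : Site d → Fin d → G) = V' := by funext y μ; simp [mulCfg]
  rw [h1, hol_one, mul_one] at h
  exact h.symm

/-- The block contours `Γ_{Lz,x}`, `x = Lz + r ∈ B(Lz)`, consist of positively oriented bonds (corner convention,
[3] p. 24; the tree's `B8Lemma1NonAbelian.forward_of_mem_treeWord`). [folklore] -/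
theorem treeWord_boxVec_forward (L : ℕ) (r : Fin d → Fin L) :
    ∀ l ∈ treeWord (boxVec L r), l = (l.1, true) :=
  fun _ hl => forward_of_mem_treeWord (boxVec_nonneg L r) hl

/-- **(1.19) ⟺ EQUALITY OF TRANSPORTERS** along a contour of positively oriented bonds: `∏_{b⊂Γ} R(V₀(Γ_{x,b₋}))
(UV₀⁻¹)_b = 1` iff `U(Γ) = V₀(Γ)` — the product telescopes to `U(Γ)V₀(Γ)⁻¹` (the tree's `covProd_eq_one_iff` /
`hol_mulCfg_eq_covProd_mul`, with (1.16) `(UV₀⁻¹)V₀ = U`). [cite: Balaban1985RegularSpaces, (1.19)-(1.20) p.79] -/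
theorem covProd_pert_eq_one_iff (V₀ U : Site d → Fin d → G) (x : Site d) (w : List (Letter d))
    (hw : ∀ l ∈ w, l = (l.1, true)) : covProd V₀ (pert U V₀) x w = 1 ↔ hol U x w = hol V₀ x w := by
  rw [covProd_eq_one_iff V₀ (pert U V₀) x w hw, mulCfg_pert]

/-- (1.19) on the block contour `Γ_{y, y+r}`, `r ∈ [0, L)ᵈ`: `∏_{b⊂Γ_{y,y+r}} R(V₀(Γ_{y,b₋}))(UV₀⁻¹)_b = 1` iff
`U(Γ_{y,y+r}) = V₀(Γ_{y,y+r})` (`B7Prop1Explicit.axialFn V y x = V(Γ_{y,x})`).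
[cite: Balaban1985RegularSpaces, (1.19) p.79] -/
theorem covProd_treeWord_eq_one_iff (V₀ U : Site d → Fin d → G) (L : ℕ) (y : Site d) (r : Fin d → Fin L) :
    covProd V₀ (pert U V₀) y (treeWord (boxVec L r)) = 1 ↔
      axialFn U y (y + boxVec L r) = axialFn V₀ y (y + boxVec L r) := by
  rw [covProd_pert_eq_one_iff V₀ U y _ (treeWord_boxVec_forward L r)]
  simp only [axialFn, add_sub_cancel_left]

/-- A group identity used twice below: `a·b·c⁻¹ = 1 ⟹ b = a⁻¹c`. [folklore] -/
theorem eq_inv_mul_of_conj_eq_one {a b c : G} (h : a * b * c⁻¹ = 1) : b = a⁻¹ * c := by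
  rw [mul_inv_eq_one] at h
  rw [← h, inv_mul_cancel_left]

/-- The tower gauge transformation (`B8Eq115GaugeFixing.tg`) of the trivial tower is trivial. [folklore] -/
theorem tg_one (L k : ℕ) (y : Site d) : ∀ n, tg L (fun _ => (1 : Site d → Fin d → G)) k y n = 1
  | 0 => by
    funext x
    simp [tg, axialFn_one]
  | n + 1 => by
    funext x
    rw [tg_succ, tg_one L k y n]
    simp [axialFn_one]

end Algebra

/-- The printed base point of a block IS the corner used by (1.15)/(1.19): `blockBase L y = L·y`. [folklore] -/
theorem blockBase_eq_smul (L : ℕ) (y : Site d) : blockBase L y = (L : ℤ) • y := by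
  funext i
  simp [blockBase]

variable {𝔸 : Type*} [NormedRing 𝔸] [NormOneClass 𝔸] [NormedAlgebra ℂ 𝔸] [CompleteSpace 𝔸]

/-! ## §2. The class `Ax_k(ℭ, U₀)` of (1.19)/(1.20) on the tower of averages (43) -/

omit [NormOneClass 𝔸] in
/-- **(1.20) on the averages**: `Ũ′ⁿ = (\overline{U′U₀})ⁿ(Ū₀ⁿ)⁻¹` — the tree's perturbation `pert` of the `n`-th
averages IS gen-21's bondwise `B8Prop6OfThm4.tavg`. [cite: Balaban1985RegularSpaces, (1.20) p.79] -/
theorem pert_avgIter (L : ℕ) (U₀ U' : Site d → Fin d → 𝔸ˣ) (n : ℕ) :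
    pert (avgIter L (U' * U₀) n) (avgIter L U₀ n) = tavg L U₀ U' n := rfl

omit [NormOneClass 𝔸] in
/-- **`W ∈ Ax_k(ℭ, U₀)`**, `ℭ = ⋃_j Λ_j`, for the full field `W` (= `U′U₀`, (1.16)) — **(1.19) verbatim** on the
`ℤᵈ` tower: "for `x₀ ∈ Bʲ(x_j)`, `x_j ∈ Λ_j`, `1 ≤ j ≤ k`, we define a sequence of points `x₀, x₁, …, x_{j−1}, x_j`
by the conditions `x_n ∈ B(x_{n+1})`, `n = 0, 1, …, j − 1`, and we put
`(R̄ⁿ_{0,x_{n+1}} Ũ′ⁿ)(Γ_{x_{n+1},x_n}) = ∏_{b⊂Γ_{x_{n+1},x_n}} R(Ū₀ⁿ(Γ_{x_{n+1},b₋})) Ũ′ⁿ_b = 1`. (1.19)",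
`Ũ′ⁿ = (\overline{U′U₀})ⁿ(Ū₀ⁿ)⁻¹` (1.20) — here `x_{n+1} = z ∈ B^{j−n−1}(x_j)` (`B8Ineq132.Under`), the corner
`Lz` of its block in the level-`n` lattice, `x_n = Lz + r`, `r ∈ [0, L)ᵈ`, `Γ_{Lz,x_n} = treeWord r` (positively
oriented), `Ū₀ⁿ = avgIter L U₀ n`, `W̄ⁿ = avgIter L W n`, the product `∏ R(Ū₀ⁿ(Γ_{·,b₋}))Ũ′ⁿ_b` = the tree's
`B8Lemma1NonAbelian.covProd`, `Ũ′ⁿ` = `pert W̄ⁿ Ū₀ⁿ`.  Same binder shape as gen-20's `B8Ineq132.InAxOne` (its case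
`U₀ = 1`, `inAx_one_iff`). [cite: Balaban1985RegularSpaces, (1.19)-(1.20) p.79 (definition of Ax_k(𝔅_k, U₀)), (1.34) p.82] -/
def InAx (L k : ℕ) (Λ : ℕ → Set (Site d)) (U₀ W : Site d → Fin d → 𝔸ˣ) : Prop :=
  ∀ j, 1 ≤ j → j ≤ k → ∀ xj ∈ Λ j, ∀ n, n < j → ∀ z : Site d, Under L (j - (n + 1)) xj z →
    ∀ r : Fin d → Fin L,
      covProd (avgIter L U₀ n) (pert (avgIter L W n) (avgIter L U₀ n)) ((L : ℤ) • z) (treeWord (boxVec L r)) = 1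

omit [NormOneClass 𝔸] in
/-- **(1.19) ⟺ `W̄ⁿ(Γ_{x_{n+1},x_n}) = Ū₀ⁿ(Γ_{x_{n+1},x_n})`** on every block contour below `ℭ`
(`covProd_treeWord_eq_one_iff`). [cite: Balaban1985RegularSpaces, (1.19) p.79] -/
theorem inAx_iff (L k : ℕ) (Λ : ℕ → Set (Site d)) (U₀ W : Site d → Fin d → 𝔸ˣ) :
    InAx L k Λ U₀ W ↔
      ∀ j, 1 ≤ j → j ≤ k → ∀ xj ∈ Λ j, ∀ n, n < j → ∀ z : Site d, Under L (j - (n + 1)) xj z →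
        ∀ r : Fin d → Fin L,
          axialFn (avgIter L W n) ((L : ℤ) • z) ((L : ℤ) • z + boxVec L r) =
            axialFn (avgIter L U₀ n) ((L : ℤ) • z) ((L : ℤ) • z + boxVec L r) := by
  simp only [InAx, covProd_treeWord_eq_one_iff]

omit [NormOneClass 𝔸] in
/-- **`Ax_k(ℭ, 1)` IS (1.15)**: for the trivial background (`1̄ⁿ = 1`, `B8Ineq132.avgIter_one`, so every
`R(Ū₀ⁿ(·)) = id` and `Ũ′ⁿ = Ū′ⁿ`) the class (1.19) is gen-20's `B8Ineq132.InAxOne` ((1.15) below `ℭ`).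
[cite: Balaban1985RegularSpaces, (1.15) p.78, (1.19)-(1.20) p.79, (1.132) p.99] -/
theorem inAx_one_iff (L k : ℕ) (Λ : ℕ → Set (Site d)) (W : Site d → Fin d → 𝔸ˣ) :
    InAx L k Λ (1 : Site d → Fin d → 𝔸ˣ) W ↔ InAxOne L k Λ W := by
  simp only [inAx_iff, InAxOne, avgIter_one, axialFn_one]

omit [NormOneClass 𝔸] in
/-- The background is on its own gauge surface: `U₀ ∈ Ax_k(ℭ, U₀)` (p. 78 "the surfaces pass through the element
`U₀`"; `U′ = 1`, `Ũ′ⁿ = 1`). [cite: Balaban1985RegularSpaces, p.78, (1.19) p.79] -/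
theorem inAx_self (L k : ℕ) (Λ : ℕ → Set (Site d)) (U₀ : Site d → Fin d → 𝔸ˣ) : InAx L k Λ U₀ U₀ := by
  intro j _ _ xj _ n _ z _ r
  rw [pert_self]
  exact covProd_one_right _ _ _

omit [NormOneClass 𝔸] in
/-- (1.19) between ALL consecutive levels `j + 1 → j`, `j < k`, at every block of `ℤᵈ` (the form delivered by
`twistedFix_global`) gives `W ∈ Ax_k(ℭ, U₀)` for every `ℭ = ⋃ Λ_j`.
[cite: Balaban1985RegularSpaces, (1.19) p.79] -/
theorem inAx_of_global {L k : ℕ} {U₀ W : Site d → Fin d → 𝔸ˣ}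
    (h19 : ∀ n, n < k → ∀ (z : Site d) (r : Fin d → Fin L),
      axialFn (avgIter L W (k - (n + 1))) ((L : ℤ) • z) ((L : ℤ) • z + boxVec L r) =
        axialFn (avgIter L U₀ (k - (n + 1))) ((L : ℤ) • z) ((L : ℤ) • z + boxVec L r))
    (Λ : ℕ → Set (Site d)) : InAx L k Λ U₀ W := by
  rw [inAx_iff]
  intro j _ hjk xj _ n hn z _ r
  have h := h19 (k - (n + 1)) (by omega) z r
  rwa [show k - (k - (n + 1) + 1) = n by omega] at h

omit [NormOneClass 𝔸] in
/-- (1.19) on the tower of cubes `□̃^{(j)} = [tlo (k − j), thi (k − j)]` gives `Ax_k(ℭ, U₀)` for every `ℭ` whose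
level-`j` pieces lie in `□̃^{(j)}` (the twisted analogue of `B8Ineq132.inAxOne_of_tower`).
[cite: Balaban1985RegularSpaces, (1.19) p.79, (1.132) p.99] -/
theorem inAx_of_tower {L : ℕ} {lo hi : Site d} {k : ℕ} {U₀ W : Site d → Fin d → 𝔸ˣ}
    (h19 : ∀ n, n < k → ∀ z, tlo L lo n ≤ z → z ≤ thi L hi n → ∀ r : Fin d → Fin L,
      axialFn (avgIter L W (k - (n + 1))) ((L : ℤ) • z) ((L : ℤ) • z + boxVec L r) =
        axialFn (avgIter L U₀ (k - (n + 1))) ((L : ℤ) • z) ((L : ℤ) • z + boxVec L r))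
    {Λ : ℕ → Set (Site d)}
    (hΛ : ∀ j, 1 ≤ j → j ≤ k → ∀ x ∈ Λ j, tlo L lo (k - j) ≤ x ∧ x ≤ thi L hi (k - j)) :
    InAx L k Λ U₀ W := by
  rw [inAx_iff]
  intro j hj1 hjk xj hxj n hn z hz r
  obtain ⟨hx, hx'⟩ := hΛ j hj1 hjk xj hxj
  obtain ⟨hz1, hz2⟩ := under_tower hx hx' hz
  have hdepth : k - j + (j - (n + 1)) = k - (n + 1) := by omega
  rw [hdepth] at hz1 hz2
  have h := h19 (k - (n + 1)) (by omega) z hz1 hz2 r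
  rwa [show k - (k - (n + 1) + 1) = n by omega] at h

/-! ## §3. p. 79: "The conditions (1.19) determine uniquely an element in each orbit given by the subgroup
(1.14)" — existence and uniqueness REDUCED to the case `U₀ = 1` ((1.15), `B8Eq115GaugeFixing`) -/

omit [NormOneClass 𝔸] in
/-- The tower gauge transformation of the trivial background is trivial (`1̄ⁿ = 1`, `1(Γ) = 1`). [folklore] -/
theorem towerGauge_one {L : ℕ} (k : ℕ) (y : Site d) :
    towerGauge L (1 : Site d → Fin d → 𝔸ˣ) k y = 1 := by
  have h1 : avgIter L (1 : Site d → Fin d → 𝔸ˣ) = fun _ => 1 := funext (avgIter_one L)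
  show tg L (avgIter L (1 : Site d → Fin d → 𝔸ˣ)) k y k = 1
  rw [h1]
  exact tg_one L k y k

omit [NormOneClass 𝔸] in
/-- **THE GAUGE TRANSFORMATION SOLVING (1.19)** (with the top level in the axial gauge RELATIVE TO `Ū₀ᵏ` at `y`,
normalised by `u(Lᵏy) = 1`): `u := v₀⁻¹·v`, where `v = towerGauge L U k y` brings `U` to (1.15) and
`v₀ = towerGauge L U₀ k y` brings `U₀` to (1.15) (`B8Eq115GaugeFixing.gaugeFix_global`) — "the axial gauge of `U`
relative to `U₀` is the axial gauge of `U` followed by the inverse of the axial gauge of `U₀`".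
[cite: Balaban1985RegularSpaces, (1.19) p.79, (1.15) p.78] -/
def twGauge (L : ℕ) (U₀ U : Site d → Fin d → 𝔸ˣ) (k : ℕ) (y : Site d) : Site d → 𝔸ˣ :=
  (towerGauge L U₀ k y)⁻¹ * towerGauge L U k y

omit [NormOneClass 𝔸] in
/-- `twGauge_apply`: unfolding. [folklore] -/
theorem twGauge_apply (L : ℕ) (U₀ U : Site d → Fin d → 𝔸ˣ) (k : ℕ) (y x : Site d) :
    twGauge L U₀ U k y x = (towerGauge L U₀ k y x)⁻¹ * towerGauge L U k y x := rfl

omit [NormOneClass 𝔸] in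
/-- For the trivial background the twisted gauge is the plain tower gauge of (1.15)/p. 98. [folklore] -/
theorem twGauge_one_bg (L : ℕ) (U : Site d → Fin d → 𝔸ˣ) (k : ℕ) (y : Site d) :
    twGauge L (1 : Site d → Fin d → 𝔸ˣ) U k y = towerGauge L U k y := by
  rw [twGauge, towerGauge_one, inv_one, one_mul]

omit [NormOneClass 𝔸] in
/-- NORMALISATION ((1.14) at the top center): `u(Lᵏy) = 1` for `u = twGauge L U₀ U k y`.
[cite: Balaban1985RegularSpaces, (1.14) p.78] -/
theorem twGauge_top {L : ℕ} (hL : 1 ≤ L) (U₀ U : Site d → Fin d → 𝔸ˣ) (k : ℕ) (y : Site d) :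
    twGauge L U₀ U k y (((L : ℤ) ^ k) • y) = 1 := by
  rw [twGauge_apply, towerGauge_top hL, towerGauge_top hL, inv_one, one_mul]

/-- **TRANSFER, (1.15) ⟹ (1.19)**: if a `G`-valued `w` brings `U` to (1.15) between all consecutive levels and to
the global axial gauge of the top level at `y`, then `v₀⁻¹·w` (`v₀ = towerGauge L U₀ k y`) brings `U` to (1.19)
relative to `U₀` between all consecutive levels (`\overline{U^{v₀⁻¹w}}ʲ(Γ_{Lz,x}) = Ū₀ʲ(Γ_{Lz,x})`) and to the
relative axial gauge of the top level (`\overline{U^{v₀⁻¹w}}ᵏ(Γ_{y,z}) = Ū₀ᵏ(Γ_{y,z})`).  Pure gauge algebra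
((8) of [3]) on top of the tree's covariance p. 78 "`(Ū^{uj})_b = (Ūʲ)ᵘ_b`" (`B7AvgGaugeCovariance.avgIter_gaugeAct`,
inside the analyticity domain of (43): the Prop. 1/2 smallness of [3] and (1.7) for `U₀` and `U`).
[cite: Balaban1985RegularSpaces, (1.19) p.79, (1.15) p.78, p.78 (covariance)] -/
theorem twisted_of_fixed (L : ℕ) (hL : 2 ≤ L) {G : Subgroup 𝔸ˣ} (hG : AvgClosed d L G) (k : ℕ)
    (U₀ U : Site d → Fin d → 𝔸ˣ) (hU₀ : ∀ x κ, U₀ x κ ∈ G) (hU : ∀ x κ, U x κ ∈ G) {α₀ : ℝ} (hα : 0 < α₀)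
    (hα3 : C0 d * (α₀ * (L : ℝ) ^ 2) ≤ 1 / 3) (hα2 : 2 * (α₀ * (L : ℝ) ^ 2) ≤ c2' d L)
    (h17₀ : pdev U₀ < α₀ * (L : ℝ) ^ 2 * (((L : ℝ) ^ k)⁻¹) ^ 2)
    (h17 : pdev U < α₀ * (L : ℝ) ^ 2 * (((L : ℝ) ^ k)⁻¹) ^ 2) (y : Site d)
    (w : Site d → 𝔸ˣ) (hw : ∀ x, w x ∈ G)
    (h15 : ∀ n, n < k → ∀ (z : Site d) (r : Fin d → Fin L),
      axialFn (avgIter L (gaugeAct w U) (k - (n + 1))) ((L : ℤ) • z) ((L : ℤ) • z + boxVec L r) = 1)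
    (htop : ∀ z, hol (avgIter L (gaugeAct w U) k) y (treeWord (z - y)) = 1) :
    (∀ n, n < k → ∀ (z : Site d) (r : Fin d → Fin L),
      axialFn (avgIter L (gaugeAct ((towerGauge L U₀ k y)⁻¹ * w) U) (k - (n + 1))) ((L : ℤ) • z)
          ((L : ℤ) • z + boxVec L r) =
        axialFn (avgIter L U₀ (k - (n + 1))) ((L : ℤ) • z) ((L : ℤ) • z + boxVec L r)) ∧
    (∀ z, hol (avgIter L (gaugeAct ((towerGauge L U₀ k y)⁻¹ * w) U) k) y (treeWord (z - y)) =
      hol (avgIter L U₀ k) y (treeWord (z - y))) := by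
  have hα' : 0 < α₀ * (L : ℝ) ^ 2 := by positivity
  obtain ⟨hv₀G, -, -, hcov₀, h15₀, htop₀⟩ := gaugeFix_global L hL hG k U₀ hU₀ hα hα3 hα2 h17₀ y
  have hv₀U : ∀ x, (towerGauge L U₀ k y)⁻¹ x ∈ U1 𝔸 := fun x => hG.le_U1 (G.inv_mem (hv₀G x))
  have hUw : ∀ x κ, gaugeAct w U x κ ∈ G := gaugeAct_mem_of hU hw
  have h17w : pdev (gaugeAct w U) < α₀ * (L : ℝ) ^ 2 * (((L : ℝ) ^ k)⁻¹) ^ 2 := by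
    rw [pdev_gaugeAct (fun x => hG.le_U1 (hw x))]; exact h17
  have hmul : gaugeAct ((towerGauge L U₀ k y)⁻¹ * w) U = gaugeAct (towerGauge L U₀ k y)⁻¹ (gaugeAct w U) :=
    gaugeAct_mul _ _ _
  have hcov : ∀ j ≤ k, avgIter L (gaugeAct ((towerGauge L U₀ k y)⁻¹ * w) U) j =
      gaugeAct (uLev L (towerGauge L U₀ k y)⁻¹ j) (avgIter L (gaugeAct w U) j) := by
    rw [hmul]
    exact avgIter_gaugeAct L hL hG k _ hUw hv₀U hα' hα3 hα2 h17w
  refine ⟨fun n hn z r => ?_, fun z => ?_⟩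
  · have e₀ := h15₀ n hn z r
    rw [hcov₀ _ (by omega), axialFn_gaugeAct] at e₀
    rw [hcov _ (by omega), axialFn_gaugeAct, h15 n hn z r, mul_one, eq_inv_mul_of_conj_eq_one e₀]
    simp only [uLev_apply, Pi.inv_apply, inv_inv]
  · have e₀ := htop₀ z
    rw [hcov₀ k le_rfl, hol_treeWord_gaugeAct] at e₀
    rw [hcov k le_rfl, hol_treeWord_gaugeAct, htop z, mul_one, eq_inv_mul_of_conj_eq_one e₀]
    simp only [uLev_apply, Pi.inv_apply, inv_inv]

/-- **TRANSFER, (1.19) ⟹ (1.15)**: conversely, if a `G`-valued `u` brings `U` to (1.19) relative to `U₀` between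
all consecutive levels and to the relative axial gauge of the top level at `y`, then `v₀·u` brings `U` to (1.15)
and to the global axial gauge of the top level. [cite: Balaban1985RegularSpaces, (1.19) p.79, (1.15) p.78] -/
theorem fixed_of_twisted (L : ℕ) (hL : 2 ≤ L) {G : Subgroup 𝔸ˣ} (hG : AvgClosed d L G) (k : ℕ)
    (U₀ U : Site d → Fin d → 𝔸ˣ) (hU₀ : ∀ x κ, U₀ x κ ∈ G) (hU : ∀ x κ, U x κ ∈ G) {α₀ : ℝ} (hα : 0 < α₀)
    (hα3 : C0 d * (α₀ * (L : ℝ) ^ 2) ≤ 1 / 3) (hα2 : 2 * (α₀ * (L : ℝ) ^ 2) ≤ c2' d L)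
    (h17₀ : pdev U₀ < α₀ * (L : ℝ) ^ 2 * (((L : ℝ) ^ k)⁻¹) ^ 2)
    (h17 : pdev U < α₀ * (L : ℝ) ^ 2 * (((L : ℝ) ^ k)⁻¹) ^ 2) (y : Site d)
    (u : Site d → 𝔸ˣ) (hu : ∀ x, u x ∈ G)
    (h19 : ∀ n, n < k → ∀ (z : Site d) (r : Fin d → Fin L),
      axialFn (avgIter L (gaugeAct u U) (k - (n + 1))) ((L : ℤ) • z) ((L : ℤ) • z + boxVec L r) =
        axialFn (avgIter L U₀ (k - (n + 1))) ((L : ℤ) • z) ((L : ℤ) • z + boxVec L r))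
    (htop : ∀ z, hol (avgIter L (gaugeAct u U) k) y (treeWord (z - y)) =
      hol (avgIter L U₀ k) y (treeWord (z - y))) :
    (∀ n, n < k → ∀ (z : Site d) (r : Fin d → Fin L),
      axialFn (avgIter L (gaugeAct (towerGauge L U₀ k y * u) U) (k - (n + 1))) ((L : ℤ) • z)
        ((L : ℤ) • z + boxVec L r) = 1) ∧
    (∀ z, hol (avgIter L (gaugeAct (towerGauge L U₀ k y * u) U) k) y (treeWord (z - y)) = 1) := by
  have hα' : 0 < α₀ * (L : ℝ) ^ 2 := by positivity
  obtain ⟨hv₀G, -, -, hcov₀, h15₀, htop₀⟩ := gaugeFix_global L hL hG k U₀ hU₀ hα hα3 hα2 h17₀ y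
  have hv₀U : ∀ x, towerGauge L U₀ k y x ∈ U1 𝔸 := fun x => hG.le_U1 (hv₀G x)
  have hUu : ∀ x κ, gaugeAct u U x κ ∈ G := gaugeAct_mem_of hU hu
  have h17u : pdev (gaugeAct u U) < α₀ * (L : ℝ) ^ 2 * (((L : ℝ) ^ k)⁻¹) ^ 2 := by
    rw [pdev_gaugeAct (fun x => hG.le_U1 (hu x))]; exact h17
  have hmul : gaugeAct (towerGauge L U₀ k y * u) U = gaugeAct (towerGauge L U₀ k y) (gaugeAct u U) :=
    gaugeAct_mul _ _ _
  have hcov : ∀ j ≤ k, avgIter L (gaugeAct (towerGauge L U₀ k y * u) U) j =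
      gaugeAct (uLev L (towerGauge L U₀ k y) j) (avgIter L (gaugeAct u U) j) := by
    rw [hmul]
    exact avgIter_gaugeAct L hL hG k _ hUu hv₀U hα' hα3 hα2 h17u
  refine ⟨fun n hn z r => ?_, fun z => ?_⟩
  · have e₀ := h15₀ n hn z r
    rw [hcov₀ _ (by omega), axialFn_gaugeAct] at e₀
    rw [hcov _ (by omega), axialFn_gaugeAct, h19 n hn z r]
    exact e₀
  · have e₀ := htop₀ z
    rw [hcov₀ k le_rfl, hol_treeWord_gaugeAct] at e₀
    rw [hcov k le_rfl, hol_treeWord_gaugeAct, htop z]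
    exact e₀

/-- **EXISTENCE OF THE GAUGE (1.19) (p. 79 "The conditions (1.19) determine uniquely an element in each orbit
given by the subgroup (1.14)"), GLOBAL CARRIER.**  Let `G` be an `AvgClosed` gauge group, `L ≥ 2`, `U₀` and `U`
`G`-valued with (1.7) `sup_p |·(∂p) − 1| < α₀L²·L^{−2k}` and `α₀L²` Prop.-1/2-small.  Then for
`u := twGauge L U₀ U k y = v₀⁻¹v` and `U^{u}`: `u` and `U^{u}` are `G`-valued; `sup_p |U^{u}(∂p) − 1| =
sup_p |U(∂p) − 1|`; `u(Lᵏy) = 1` ((1.14) at the top center); (1.19) holds between ALL consecutive levels: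
`\overline{U^{u}}ʲ(Γ_{Lz,x}) = Ū₀ʲ(Γ_{Lz,x})`, `x ∈ B(Lz)`, all `z`, `j < k` (equivalently, by
`covProd_treeWord_eq_one_iff`, the printed products (1.19) are `1`); and the top level is in the axial gauge relative to
`Ū₀ᵏ` at `y`: `\overline{U^{u}}ᵏ(Γ_{y,z}) = Ū₀ᵏ(Γ_{y,z})` for all `z`.  For `U₀ = 1` this is
`B8Eq115GaugeFixing.gaugeFix_global` (`twGauge_one_bg`). [cite: Balaban1985RegularSpaces, (1.19) p.79, (1.14) p.78] -/
theorem twistedFix_global (L : ℕ) (hL : 2 ≤ L) {G : Subgroup 𝔸ˣ} (hG : AvgClosed d L G) (k : ℕ)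
    (U₀ U : Site d → Fin d → 𝔸ˣ) (hU₀ : ∀ x κ, U₀ x κ ∈ G) (hU : ∀ x κ, U x κ ∈ G) {α₀ : ℝ} (hα : 0 < α₀)
    (hα3 : C0 d * (α₀ * (L : ℝ) ^ 2) ≤ 1 / 3) (hα2 : 2 * (α₀ * (L : ℝ) ^ 2) ≤ c2' d L)
    (h17₀ : pdev U₀ < α₀ * (L : ℝ) ^ 2 * (((L : ℝ) ^ k)⁻¹) ^ 2)
    (h17 : pdev U < α₀ * (L : ℝ) ^ 2 * (((L : ℝ) ^ k)⁻¹) ^ 2) (y : Site d) :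
    (∀ x, twGauge L U₀ U k y x ∈ G) ∧
    (∀ x κ, gaugeAct (twGauge L U₀ U k y) U x κ ∈ G) ∧
    pdev (gaugeAct (twGauge L U₀ U k y) U) = pdev U ∧
    twGauge L U₀ U k y (((L : ℤ) ^ k) • y) = 1 ∧
    (∀ n, n < k → ∀ (z : Site d) (r : Fin d → Fin L),
      axialFn (avgIter L (gaugeAct (twGauge L U₀ U k y) U) (k - (n + 1))) ((L : ℤ) • z)
          ((L : ℤ) • z + boxVec L r) =
        axialFn (avgIter L U₀ (k - (n + 1))) ((L : ℤ) • z) ((L : ℤ) • z + boxVec L r)) ∧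
    (∀ z, hol (avgIter L (gaugeAct (twGauge L U₀ U k y) U) k) y (treeWord (z - y)) =
      hol (avgIter L U₀ k) y (treeWord (z - y))) := by
  have hL1 : 1 ≤ L := le_trans (by norm_num) hL
  obtain ⟨hv₀G, -, -, -, -, -⟩ := gaugeFix_global L hL hG k U₀ hU₀ hα hα3 hα2 h17₀ y
  obtain ⟨hvG, -, -, -, h15, htop⟩ := gaugeFix_global L hL hG k U hU hα hα3 hα2 h17 y
  have huG : ∀ x, twGauge L U₀ U k y x ∈ G := fun x => G.mul_mem (G.inv_mem (hv₀G x)) (hvG x)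
  exact ⟨huG, gaugeAct_mem_of hU huG, pdev_gaugeAct (fun x => hG.le_U1 (huG x)) U, twGauge_top hL1 U₀ U k y,
    twisted_of_fixed L hL hG k U₀ U hU₀ hU hα hα3 hα2 h17₀ h17 y (towerGauge L U k y) hvG h15 htop⟩

/-- Hence `U^{u} ∈ Ax_k(ℭ, U₀)` for every `ℭ`, `u = twGauge L U₀ U k y` — an element of the orbit of `U`
satisfying (1.19). [cite: Balaban1985RegularSpaces, (1.19) p.79] -/
theorem inAx_twistedFix (L : ℕ) (hL : 2 ≤ L) {G : Subgroup 𝔸ˣ} (hG : AvgClosed d L G) (k : ℕ)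
    (U₀ U : Site d → Fin d → 𝔸ˣ) (hU₀ : ∀ x κ, U₀ x κ ∈ G) (hU : ∀ x κ, U x κ ∈ G) {α₀ : ℝ} (hα : 0 < α₀)
    (hα3 : C0 d * (α₀ * (L : ℝ) ^ 2) ≤ 1 / 3) (hα2 : 2 * (α₀ * (L : ℝ) ^ 2) ≤ c2' d L)
    (h17₀ : pdev U₀ < α₀ * (L : ℝ) ^ 2 * (((L : ℝ) ^ k)⁻¹) ^ 2)
    (h17 : pdev U < α₀ * (L : ℝ) ^ 2 * (((L : ℝ) ^ k)⁻¹) ^ 2) (y : Site d) (Λ : ℕ → Set (Site d)) :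
    InAx L k Λ U₀ (gaugeAct (twGauge L U₀ U k y) U) :=
  inAx_of_global (twistedFix_global L hL hG k U₀ U hU₀ hU hα hα3 hα2 h17₀ h17 y).2.2.2.2.1 Λ

/-- **UNIQUENESS UP TO THE RESIDUAL FREEDOM** (p. 79): two `G`-valued `u₁`, `u₂` both bringing `U` to (1.19)
relative to `U₀` between all consecutive levels and to the relative axial gauge of the top level at `y` differ by
a constant CONJUGATED BY THE BACKGROUND'S AXIAL GAUGE: `u₂(x) = v₀(x)⁻¹·c·v₀(x)·u₁(x)`,
`c = u₂(Lᵏy)u₁(Lᵏy)⁻¹`, `v₀ = towerGauge L U₀ k y` (for `U₀ = 1`: `u₂ = c·u₁`, `B8Eq115GaugeFixing.gaugeFix_unique`);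
print's normalisation (1.14) makes `c = 1`. [cite: Balaban1985RegularSpaces, (1.19) p.79, (1.14) p.78] -/
theorem twistedFix_unique (L : ℕ) (hL : 2 ≤ L) {G : Subgroup 𝔸ˣ} (hG : AvgClosed d L G) (k : ℕ)
    (U₀ U : Site d → Fin d → 𝔸ˣ) (hU₀ : ∀ x κ, U₀ x κ ∈ G) (hU : ∀ x κ, U x κ ∈ G) {α₀ : ℝ} (hα : 0 < α₀)
    (hα3 : C0 d * (α₀ * (L : ℝ) ^ 2) ≤ 1 / 3) (hα2 : 2 * (α₀ * (L : ℝ) ^ 2) ≤ c2' d L)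
    (h17₀ : pdev U₀ < α₀ * (L : ℝ) ^ 2 * (((L : ℝ) ^ k)⁻¹) ^ 2)
    (h17 : pdev U < α₀ * (L : ℝ) ^ 2 * (((L : ℝ) ^ k)⁻¹) ^ 2) (y : Site d)
    (u₁ u₂ : Site d → 𝔸ˣ) (hu₁ : ∀ x, u₁ x ∈ G) (hu₂ : ∀ x, u₂ x ∈ G)
    (h19₁ : ∀ n, n < k → ∀ (z : Site d) (r : Fin d → Fin L),
      axialFn (avgIter L (gaugeAct u₁ U) (k - (n + 1))) ((L : ℤ) • z) ((L : ℤ) • z + boxVec L r) =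
        axialFn (avgIter L U₀ (k - (n + 1))) ((L : ℤ) • z) ((L : ℤ) • z + boxVec L r))
    (h19₂ : ∀ n, n < k → ∀ (z : Site d) (r : Fin d → Fin L),
      axialFn (avgIter L (gaugeAct u₂ U) (k - (n + 1))) ((L : ℤ) • z) ((L : ℤ) • z + boxVec L r) =
        axialFn (avgIter L U₀ (k - (n + 1))) ((L : ℤ) • z) ((L : ℤ) • z + boxVec L r))
    (htop₁ : ∀ z, hol (avgIter L (gaugeAct u₁ U) k) y (treeWord (z - y)) =
      hol (avgIter L U₀ k) y (treeWord (z - y)))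
    (htop₂ : ∀ z, hol (avgIter L (gaugeAct u₂ U) k) y (treeWord (z - y)) =
      hol (avgIter L U₀ k) y (treeWord (z - y))) :
    ∀ x, u₂ x = (towerGauge L U₀ k y x)⁻¹ * (u₂ (((L : ℤ) ^ k) • y) * (u₁ (((L : ℤ) ^ k) • y))⁻¹) *
      towerGauge L U₀ k y x * u₁ x := by
  have hL1 : 1 ≤ L := le_trans (by norm_num) hL
  obtain ⟨hv₀G, -, -, -, -, -⟩ := gaugeFix_global L hL hG k U₀ hU₀ hα hα3 hα2 h17₀ y
  obtain ⟨h15₁, ht₁⟩ := fixed_of_twisted L hL hG k U₀ U hU₀ hU hα hα3 hα2 h17₀ h17 y u₁ hu₁ h19₁ htop₁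
  obtain ⟨h15₂, ht₂⟩ := fixed_of_twisted L hL hG k U₀ U hU₀ hU hα hα3 hα2 h17₀ h17 y u₂ hu₂ h19₂ htop₂
  have hw₁ : ∀ x, (towerGauge L U₀ k y * u₁) x ∈ G := fun x => G.mul_mem (hv₀G x) (hu₁ x)
  have hw₂ : ∀ x, (towerGauge L U₀ k y * u₂) x ∈ G := fun x => G.mul_mem (hv₀G x) (hu₂ x)
  intro x
  have hc := gaugeFix_unique L hL hG k U hU hα hα3 hα2 h17 y (towerGauge L U₀ k y * u₁)
    (towerGauge L U₀ k y * u₂) hw₁ hw₂ h15₁ h15₂ ht₁ ht₂ x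
  simp only [Pi.mul_apply] at hc
  rw [towerGauge_top hL1, one_mul, one_mul] at hc
  calc u₂ x = (towerGauge L U₀ k y x)⁻¹ * (towerGauge L U₀ k y x * u₂ x) := (inv_mul_cancel_left _ _).symm
    _ = _ := by rw [hc]; simp only [mul_assoc]

/-- **EXACT UNIQUENESS UNDER THE NORMALISATION `u(Lᵏy) = 1`** (p. 79 "The conditions (1.19) determine uniquely an
element in each orbit given by the subgroup (1.14)"): a `G`-valued `u` with `u(Lᵏy) = 1` bringing `U` to (1.19)
relative to `U₀` between all consecutive levels and to the relative axial gauge of the top level at `y` IS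
`twGauge L U₀ U k y`. [cite: Balaban1985RegularSpaces, (1.19) p.79, (1.14) p.78] -/
theorem twistedFix_unique_normalised (L : ℕ) (hL : 2 ≤ L) {G : Subgroup 𝔸ˣ} (hG : AvgClosed d L G) (k : ℕ)
    (U₀ U : Site d → Fin d → 𝔸ˣ) (hU₀ : ∀ x κ, U₀ x κ ∈ G) (hU : ∀ x κ, U x κ ∈ G) {α₀ : ℝ} (hα : 0 < α₀)
    (hα3 : C0 d * (α₀ * (L : ℝ) ^ 2) ≤ 1 / 3) (hα2 : 2 * (α₀ * (L : ℝ) ^ 2) ≤ c2' d L)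
    (h17₀ : pdev U₀ < α₀ * (L : ℝ) ^ 2 * (((L : ℝ) ^ k)⁻¹) ^ 2)
    (h17 : pdev U < α₀ * (L : ℝ) ^ 2 * (((L : ℝ) ^ k)⁻¹) ^ 2) (y : Site d)
    (u : Site d → 𝔸ˣ) (hu : ∀ x, u x ∈ G) (hnorm : u (((L : ℤ) ^ k) • y) = 1)
    (h19 : ∀ n, n < k → ∀ (z : Site d) (r : Fin d → Fin L),
      axialFn (avgIter L (gaugeAct u U) (k - (n + 1))) ((L : ℤ) • z) ((L : ℤ) • z + boxVec L r) =
        axialFn (avgIter L U₀ (k - (n + 1))) ((L : ℤ) • z) ((L : ℤ) • z + boxVec L r))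
    (htop : ∀ z, hol (avgIter L (gaugeAct u U) k) y (treeWord (z - y)) =
      hol (avgIter L U₀ k) y (treeWord (z - y))) :
    u = twGauge L U₀ U k y := by
  have hL1 : 1 ≤ L := le_trans (by norm_num) hL
  obtain ⟨hv₀G, -, -, -, -, -⟩ := gaugeFix_global L hL hG k U₀ hU₀ hα hα3 hα2 h17₀ y
  obtain ⟨h15, ht⟩ := fixed_of_twisted L hL hG k U₀ U hU₀ hU hα hα3 hα2 h17₀ h17 y u hu h19 htop
  have hw : ∀ x, (towerGauge L U₀ k y * u) x ∈ G := fun x => G.mul_mem (hv₀G x) (hu x)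
  have hwn : (towerGauge L U₀ k y * u) (((L : ℤ) ^ k) • y) = 1 := by
    rw [Pi.mul_apply, towerGauge_top hL1, hnorm, one_mul]
  have h := gaugeFix_unique_normalised L hL hG k U hU hα hα3 hα2 h17 y (towerGauge L U₀ k y * u) hw hwn h15 ht
  show u = (towerGauge L U₀ k y)⁻¹ * towerGauge L U k y
  exact eq_inv_mul_of_mul_eq h

/-- **THE RESIDUAL FREEDOM ACTS** (converse of `twistedFix_unique`): if `u` brings `U` to (1.19) relative to `U₀`
(all levels + relative top gauge at `y`), then so does `x ↦ v₀(x)⁻¹·c·v₀(x)·u(x)` for every constant `c ∈ G`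
(transfer to (1.15), `B8Eq115GaugeFixing.gaugeFix_const_mul`, transfer back).  Hence the solutions of (1.19) + the
relative top gauge in the orbit of `U` are EXACTLY these transforms of `twGauge L U₀ U k y`.
[cite: Balaban1985RegularSpaces, (1.19) p.79, (1.14) p.78] -/
theorem twistedFix_conjConst_mul (L : ℕ) (hL : 2 ≤ L) {G : Subgroup 𝔸ˣ} (hG : AvgClosed d L G) (k : ℕ)
    (U₀ U : Site d → Fin d → 𝔸ˣ) (hU₀ : ∀ x κ, U₀ x κ ∈ G) (hU : ∀ x κ, U x κ ∈ G) {α₀ : ℝ} (hα : 0 < α₀)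
    (hα3 : C0 d * (α₀ * (L : ℝ) ^ 2) ≤ 1 / 3) (hα2 : 2 * (α₀ * (L : ℝ) ^ 2) ≤ c2' d L)
    (h17₀ : pdev U₀ < α₀ * (L : ℝ) ^ 2 * (((L : ℝ) ^ k)⁻¹) ^ 2)
    (h17 : pdev U < α₀ * (L : ℝ) ^ 2 * (((L : ℝ) ^ k)⁻¹) ^ 2) (y : Site d)
    (u : Site d → 𝔸ˣ) (hu : ∀ x, u x ∈ G) {c : 𝔸ˣ} (hc : c ∈ G)
    (h19 : ∀ n, n < k → ∀ (z : Site d) (r : Fin d → Fin L),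
      axialFn (avgIter L (gaugeAct u U) (k - (n + 1))) ((L : ℤ) • z) ((L : ℤ) • z + boxVec L r) =
        axialFn (avgIter L U₀ (k - (n + 1))) ((L : ℤ) • z) ((L : ℤ) • z + boxVec L r))
    (htop : ∀ z, hol (avgIter L (gaugeAct u U) k) y (treeWord (z - y)) =
      hol (avgIter L U₀ k) y (treeWord (z - y))) :
    (∀ n, n < k → ∀ (z : Site d) (r : Fin d → Fin L),
      axialFn (avgIter L (gaugeAct (fun x => (towerGauge L U₀ k y x)⁻¹ * c * towerGauge L U₀ k y x * u x) U)
          (k - (n + 1))) ((L : ℤ) • z) ((L : ℤ) • z + boxVec L r) =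
        axialFn (avgIter L U₀ (k - (n + 1))) ((L : ℤ) • z) ((L : ℤ) • z + boxVec L r)) ∧
    (∀ z, hol (avgIter L (gaugeAct (fun x => (towerGauge L U₀ k y x)⁻¹ * c * towerGauge L U₀ k y x * u x) U) k)
        y (treeWord (z - y)) = hol (avgIter L U₀ k) y (treeWord (z - y))) := by
  obtain ⟨hv₀G, -, -, -, -, -⟩ := gaugeFix_global L hL hG k U₀ hU₀ hα hα3 hα2 h17₀ y
  obtain ⟨h15, ht⟩ := fixed_of_twisted L hL hG k U₀ U hU₀ hU hα hα3 hα2 h17₀ h17 y u hu h19 htop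
  have hw : ∀ x, (towerGauge L U₀ k y * u) x ∈ G := fun x => G.mul_mem (hv₀G x) (hu x)
  obtain ⟨h15c, htc⟩ :=
    gaugeFix_const_mul L hL hG k U hU hα hα3 hα2 h17 y (towerGauge L U₀ k y * u) hw hc h15 ht
  have hwc : ∀ x, (fun x => c * (towerGauge L U₀ k y * u) x) x ∈ G := fun x => G.mul_mem hc (hw x)
  have key := twisted_of_fixed L hL hG k U₀ U hU₀ hU hα hα3 hα2 h17₀ h17 y
    (fun x => c * (towerGauge L U₀ k y * u) x) hwc h15c htc
  have hfun : (towerGauge L U₀ k y)⁻¹ * (fun x => c * (towerGauge L U₀ k y * u) x) =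
      fun x => (towerGauge L U₀ k y x)⁻¹ * c * towerGauge L U₀ k y x * u x := by
    funext x
    simp only [Pi.mul_apply, Pi.inv_apply, mul_assoc]
  rw [hfun] at key
  exact key

/-! ## §4. Theorem 4 (p. 88) as an interface FOR A GENERAL BACKGROUND; the pair `1, U₀″` of p. 99 -/

omit [NormOneClass 𝔸] in
/-- **INTERFACE (HYPOTHESIS SHAPE) — Theorem 4, p. 88, for a general background on the admissible family `{□_j}`
of (1.131)** (`Ω_j = □_j = B8Eq131Cubes.cube`, `𝔅_k = ℭ_k = ⋃ Λ′_j`, `Λ′_j = B8Eq131Cubes.LamP`): "There exists a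
constant `c₁` such that for arbitrary `U₀`, `U′U₀` satisfying (1.33), (1.34), (1.66) with `α₀ + α₁ ≤ c₁` there
exists exactly one gauge transformation `u` satisfying (1.29) and such that the conditions (1.37), (1.38), (1.62)
hold for the configuration `U₁ = U′^{u⁻¹}`."  Typed: (1.33) = `U₀ ∈ 𝔄_k({□_j}, α₀)` (`B8Ineq132.InAk`) `∧ Reg U₀`
(`Reg` abstracts "`U₀` satisfies the regularity condition (3.35) in [4]"); (1.34) = `U′U₀ ∈ 𝔄_k({□_j}, α₀) ∩
Ax_k(ℭ_k, U₀)` (`InAk (U′·U₀)`, `InAx … U₀ (U′·U₀)`, (1.16) `U = U′U₀` bondwise); (1.66) = `B8Prop6OfThm4.Cond166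
U₀ U′ α₁` (`|Ũ′ʲ − 1| < α₁` on `□_j^{(j)}`, (1.20)); `Restr U₀ u` abstracts "`u` satisfies (1.29)" (its `ℤᵈ`-block
typing is `Restr129` below); `Concl α₀ α₁ U₀ U′ u` abstracts "(1.37), (1.38), (1.62) hold for `U₁ = U′^{u⁻¹}`";
`u` ranges over `G`-valued gauge transformations.  A HYPOTHESIS of `prop6_of_thm4At`, never instantiated in the
tree. [cite: Balaban1985RegularSpaces, Thm. 4 p.88, (1.33)-(1.34) p.82, (1.66) p.87, (1.29) p.81, (1.19)-(1.20) p.79] -/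
def Thm4At (L k : ℕ) (η c₁ : ℝ) (G : Subgroup 𝔸ˣ) (a : Site d) (M ρ : ℕ)
    (Reg : (Site d → Fin d → 𝔸ˣ) → Prop)
    (Restr : (Site d → Fin d → 𝔸ˣ) → (Site d → 𝔸ˣ) → Prop)
    (Concl : ℝ → ℝ → (Site d → Fin d → 𝔸ˣ) → (Site d → Fin d → 𝔸ˣ) → (Site d → 𝔸ˣ) → Prop) : Prop :=
  ∀ ⦃α₀ α₁ : ℝ⦄, 0 < α₀ → 0 < α₁ → α₀ + α₁ ≤ c₁ →
    ∀ U₀ U' : Site d → Fin d → 𝔸ˣ, (∀ x κ, U₀ x κ ∈ G) → (∀ x κ, U' x κ ∈ G) →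
      InAk L k η α₀ (cube L a M ρ k) U₀ → Reg U₀ →
      InAk L k η α₀ (cube L a M ρ k) (U' * U₀) → InAx L k (LamP L a M ρ k) U₀ (U' * U₀) →
      Cond166 L k a M ρ U₀ U' α₁ →
      ∃ u : Site d → 𝔸ˣ, ((∀ x, u x ∈ G) ∧ Restr U₀ u ∧ Concl α₀ α₁ U₀ U' u) ∧
        ∀ u' : Site d → 𝔸ˣ, (∀ x, u' x ∈ G) → Restr U₀ u' → Concl α₀ α₁ U₀ U' u' → u' = u

omit [NormOneClass 𝔸] in
/-- **THE PAIR `1, U′` (p. 99)**: Theorem 4 for a general background, together with "(3.35) of [4]" for the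
configuration `1` (print, p. 99: "hence for `α₀` sufficiently small we have proved the regularity condition
(3.35). This implies that we can drop out this condition from the assumption (1.33)" — kept here as the displayed
hypothesis `Reg 1`), gives gen-21's interface `B8Prop6OfThm4.Thm4AtOne` for the background `1`: (1.34) for the pair
is `U′·1 = U′ ∈ 𝔄_k` and `U′ ∈ Ax_k(ℭ_k, 1)` (`inAx_one_iff`), (1.66) for the pair is (1.133)'s shape.
[cite: Balaban1985RegularSpaces, Thm. 4 p.88, p.99 ("the pair of configurations 1, U₀″")] -/
theorem thm4AtOne_of_thm4At {L k : ℕ} {η c₁ : ℝ} {G : Subgroup 𝔸ˣ} {a : Site d} {M ρ : ℕ}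
    {Reg : (Site d → Fin d → 𝔸ˣ) → Prop} {Restr : (Site d → Fin d → 𝔸ˣ) → (Site d → 𝔸ˣ) → Prop}
    {Concl : ℝ → ℝ → (Site d → Fin d → 𝔸ˣ) → (Site d → Fin d → 𝔸ˣ) → (Site d → 𝔸ˣ) → Prop}
    (h : Thm4At L k η c₁ G a M ρ Reg Restr Concl) (hReg : Reg 1) :
    Thm4AtOne L k η c₁ G a M ρ (Restr 1) (fun α₀ α₁ U' u => Concl α₀ α₁ 1 U' u) := by
  intro α₀ α₁ hα₀ hα₁ hc U' hU' h1 hA hAx h166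
  have hA' : InAk L k η α₀ (cube L a M ρ k) (U' * 1) := by rwa [mul_one]
  have hAx' : InAx L k (LamP L a M ρ k) (1 : Site d → Fin d → 𝔸ˣ) (U' * 1) := by
    rw [mul_one]; exact (inAx_one_iff L k _ U').2 hAx
  exact h hα₀ hα₁ hc 1 U' (fun _ _ => G.one_mem) hU' h1 hReg hA' hAx' h166

/-- **PROPOSITION 6 FROM THEOREM 4 STATED FOR A GENERAL BACKGROUND** (p. 99: "If `7dL²Mα₀ ≤ c₁`, then the
assumptions of Theorem 4 are satisfied for the pair of configurations `1, U₀″`, thus there exists a gauge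
transformation `u` such that `U₁ = U₀″^{u⁻¹}` satisfies the conditions (1.36)–(1.39)"): gen-21's
`B8Prop6OfThm4.prop6_of_thm4` with its interface supplied by `thm4AtOne_of_thm4At` — same hypotheses (Sect. F
setting of `B8Eq131Cubes.ineq132_cubes`, `L³α₀ + 6dL²Mα₀ ≤ c₁`) plus `Reg 1`; conclusion: a `G`-valued `u` with
(1.29) relative to the background `1` [`Restr 1 u`], (1.36)–(1.39) for `U₁ = U₀″^{u⁻¹}` with the constants
`(L³α₀, 6dL²Mα₀)` [`Concl … 1 U₀″ u`], unique among such, `w = v⁻¹u` `G`-valued, and (1.135) `U₀^{w⁻¹} = U₀″^{u⁻¹}`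
on `□̃`. [cite: Balaban1985RegularSpaces, Prop. 6 (1.135) p.99, Thm. 4 p.88] -/
theorem prop6_of_thm4At (L : ℕ) (hL : 2 ≤ L) (hd : 1 ≤ d) {G : Subgroup 𝔸ˣ} (hG : AvgClosed d L G) (k : ℕ)
    (U₀ : Site d → Fin d → 𝔸ˣ) (hU : ∀ x κ, U₀ x κ ∈ G) {α₀ : ℝ} (hα : 0 < α₀)
    (hα3 : C0 d * (α₀ * (L : ℝ) ^ 2) ≤ 1 / 3) (hα2 : 2 * (α₀ * (L : ℝ) ^ 2) ≤ c2' d L)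
    (a : Site d) {M ρ : ℕ} (hρ : 1 ≤ ρ) (hρM : ρ ≤ M) (hM : 11 * (d : ℝ) < M)
    {η : ℝ} (hη : 0 < η) {Ω : ℕ → Set (Site d)} (hA : InAk L k η α₀ Ω U₀) (hT : tcube L a M ρ k ⊆ Ω (k - 1))
    (hsmall : 11 * (d : ℝ) ^ 2 * (L : ℝ) ^ 2 * α₀ + ((M : ℝ) + 4 * ρ) * d * (L : ℝ) ^ 2 * α₀ ≤ 1 / 6)
    {c₁ : ℝ} {Reg : (Site d → Fin d → 𝔸ˣ) → Prop} {Restr : (Site d → Fin d → 𝔸ˣ) → (Site d → 𝔸ˣ) → Prop}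
    {Concl : ℝ → ℝ → (Site d → Fin d → 𝔸ˣ) → (Site d → Fin d → 𝔸ˣ) → (Site d → 𝔸ˣ) → Prop}
    (hThm4 : Thm4At L k η c₁ G a M ρ Reg Restr Concl) (hReg : Reg 1)
    (hc₁ : (L : ℝ) ^ 3 * α₀ + 6 * d * (L : ℝ) ^ 2 * M * α₀ ≤ c₁) :
    ∃ u : Site d → 𝔸ˣ, (∀ x, u x ∈ G) ∧ Restr 1 u ∧
      Concl ((L : ℝ) ^ 3 * α₀) (6 * d * (L : ℝ) ^ 2 * M * α₀) 1
        (cutFixed L (tLo a ρ) (tHi a M ρ) U₀ k (ctr a M)) u ∧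
      (∀ u' : Site d → 𝔸ˣ, (∀ x, u' x ∈ G) → Restr 1 u' →
        Concl ((L : ℝ) ^ 3 * α₀) (6 * d * (L : ℝ) ^ 2 * M * α₀) 1
          (cutFixed L (tLo a ρ) (tHi a M ρ) U₀ k (ctr a M)) u' → u' = u) ∧
      (∀ x, ((localGauge L (tLo a ρ) (tHi a M ρ) U₀ k (ctr a M))⁻¹ * u) x ∈ G) ∧
      AgreeOn (tlo L (tLo a ρ) k) (thi L (tHi a M ρ) k)
        (gaugeAct ((localGauge L (tLo a ρ) (tHi a M ρ) U₀ k (ctr a M))⁻¹ * u)⁻¹ U₀)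
        (gaugeAct u⁻¹ (cutFixed L (tLo a ρ) (tHi a M ρ) U₀ k (ctr a M))) :=
  prop6_of_thm4 L hL hd hG k U₀ hU hα hα3 hα2 a hρ hρM hM hη hA hT hsmall (thm4AtOne_of_thm4At hThm4 hReg) hc₁

/-! ## §5. (1.29) "`(R̄₀uʲ)(y) = 1` for `y ∈ Λ_j`, `j = 0, 1, …, k`" typed on the `ℤᵈ` blocks: the averaging
(79)–(80) of [3] for gauge transformations with the background transporters `Ū₀ʲ(Γ_{y,x})` -/

omit [NormOneClass 𝔸] in
/-- **The level transporters of the background**: `T_j(y, x) = Ū₀ʲ(Γ_{Ly,x})` — the parallel transporter of the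
`j`-th average of `U₀` along the block contour from the corner `Ly` of `B(y)` to `x ∈ B(y)` (the `V₀(Γ_{y,x})` of
(78) with `V₀ = Ū₀ʲ`, (80)). [cite: Balaban1985Averaging, (78)-(80) p.30; Balaban1985RegularSpaces, (1.29) p.81] -/
def bgT (L : ℕ) (U₀ : Site d → Fin d → 𝔸ˣ) : ℕ → Site d → Site d → 𝔸ˣ :=
  fun j y x => axialFn (avgIter L U₀ j) (blockBase L y) x

omit [NormOneClass 𝔸] in
/-- For the trivial background all transporters are `1` ((79)–(80) become the plain averaging of [3] (78) with
`V₀ = 1`). [folklore] -/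
theorem bgT_one (L : ℕ) : bgT L (1 : Site d → Fin d → 𝔸ˣ) = fun _ _ _ => 1 := by
  funext j y x
  simp [bgT, avgIter_one, axialFn_one]

omit [NormOneClass 𝔸] in
/-- **(1.29) TYPED**: "`(R̄₀uʲ)(y) = 1` for `y ∈ Λ_j`, `j = 0, 1, …, k`" — `R̄₀uʲ` the `j`-th order averaging
operation (79)–(80) of [3] for gauge transformations (`B7Eq78Linearization.Rbar` on the `ℤᵈ` blocks
`B7Eq78Linearization.zdBlocking d L`: blocks `{Ly + t}`, base point `Ly`, weights `L⁻ᵈ`), taken with the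
background transporters `bgT L U₀` (`R(U₀)`, `R(Ū₀ʲ)` in (79)/(80)); `u` the gauge transformation on the finest
lattice, `Λ j` the level-`j` set in level-`j` coordinates.  The candidate instance of the abstract `Restr U₀ u` of
`Thm4At` (not wired into it: `Concl` stays untyped). [cite: Balaban1985RegularSpaces, (1.29) p.81; Balaban1985Averaging, (78)-(80) p.30] -/
def Restr129 (L k : ℕ) (Λ : ℕ → Set (Site d)) (U₀ : Site d → Fin d → 𝔸ˣ) (u : Site d → 𝔸ˣ) : Prop :=
  ∀ j, j ≤ k → ∀ y ∈ Λ j, Rbar (zdBlocking d L) (bgT L U₀) j (fun x => ((u x : 𝔸ˣ) : 𝔸)) y = 1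

omit [NormOneClass 𝔸] in
/-- (1.29) at `j = 0` reads `u(y) = 1` for `y ∈ Λ₀` (`R̄₀u⁰ = u`) — (1.14) on `Λ₀`.
[cite: Balaban1985RegularSpaces, (1.29) p.81, (1.14) p.78] -/
theorem restr129_level_zero {L k : ℕ} {Λ : ℕ → Set (Site d)} {U₀ : Site d → Fin d → 𝔸ˣ} {u : Site d → 𝔸ˣ}
    (h : Restr129 L k Λ U₀ u) {y : Site d} (hy : y ∈ Λ 0) : ((u y : 𝔸ˣ) : 𝔸) = 1 := by
  have h0 := h 0 (Nat.zero_le _) y hy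
  rwa [Rbar_zero] at h0

omit [NormOneClass 𝔸] in
/-- (1.29) relative to the trivial background is the condition on the PLAIN averages `R̄uʲ` of (78) with all
transporters `1` (the `(\overline{R₀u})ʲ` of p. 81 for `U₀ = 1`). [cite: Balaban1985RegularSpaces, (1.29) p.81] -/
theorem restr129_one_iff (L k : ℕ) (Λ : ℕ → Set (Site d)) (u : Site d → 𝔸ˣ) :
    Restr129 L k Λ (1 : Site d → Fin d → 𝔸ˣ) u ↔
      ∀ j, j ≤ k → ∀ y ∈ Λ j, Rbar (zdBlocking d L) (fun _ _ _ => (1 : 𝔸ˣ)) j (fun x => ((u x : 𝔸ˣ) : 𝔸)) y = 1 := by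
  simp only [Restr129, bgT_one]

end Literature.MathematicalPhysics.QuantumFieldTheory.Balaban1983to89.B8Eq119TwistedAxial
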